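import Mathlib.MeasureTheory.Measure.Typeclasses.Probability
import Mathlib.MeasureTheory.Measure.Dirac
import Mathlib.MeasureTheory.Integral.Bochner.Basic
import Mathlib.Algebra.Group.Fin.Basic
import HarnessLib

/-!
# Complete and joint mixability (Wang–Wang)

A probability distribution `F` on `ℝ` is **`n`-completely mixable** (`n`-CM) with *centre* `c`
if there is a random vector `(X₁, …, Xₙ)` with every `Xᵢ ∼ F` and `X₁ + ⋯ + Xₙ = n c` almost
surely; more generally an `n`-tuple `(F₁, …, Fₙ)` is **jointly mixable** with *joint centre* `K`
if there is a random vector with marginals `Fᵢ` and constant sum `K` (a *joint mix*)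
[cite: Wang2015CM, Definition 3 and §1.3; WangWang2011, Definition 2.1].  The notion was coined
in B. Wang–R. Wang (2011) and is surveyed in R. Wang (2015).

We phrase everything for LAWS: a joint mix is a probability measure `P` on `Fin n → ℝ` with
prescribed coordinate marginals `P.map (· i)` and `∑ i, x i = K` for `P`-a.e. `x`.

## Contents (all proved, Mathlib only)

* `IsJointlyMixable`, `IsCompletelyMixable` — the definitions; `isCompletelyMixable_iff`.
* `IsJointlyMixable.isProbabilityMeasure` — the marginals of a joint mix are probability laws.
* `IsJointlyMixable.comp_perm` — joint mixability is invariant under permuting the tuple.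
* `IsCompletelyMixable.exists_perm_invariant` — an `n`-CM law is the common marginal of a
  joint mix whose law is invariant under all coordinate permutations (symmetrisation): the
  dictionary «`F` is `n`-CM with centre `c`» ⇔ «`F` is the one-dimensional marginal of an
  exchangeable law on the hyperplane `{∑ xᵢ = n c}`» [cite: Wang2015CM, Theorem 2 (proof)].
* `IsCompletelyMixable.measure_Ioi_eq_zero` / `measure_Iio_eq_zero` and
  `IsCompletelyMixable.mean_condition_left` / `mean_condition_right` — the NECESSARY mean
  condition `a + (b-a)/n ≤ c ≤ b - (b-a)/n` for a law carried by `[a, b]`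
  [cite: Wang2015CM, §2.4 (meancd1); WangWang2011, Proposition 2.1].
* `isCompletelyMixable_two_iff` — `F` is `2`-CM with centre `c` iff `F` is symmetric about `c`
  [cite: PuccettiWang2015, §3.3 (before Definition 11)].
* `IsJointlyMixable.convexCombo` / `IsCompletelyMixable.convexCombo` — mixability is preserved
  by convex combinations (mix the joint mixes).
* `isCompletelyMixable_discreteUniform` — the `n`-point discrete uniform law on the coordinates
  of `a : Fin n → ℝ` is `n`-CM with centre `(∑ i, a i)/n` (cyclic-shift coupling); with the previous
  item this is the easy half of the representation theorem [cite: Wang2015CM, Theorem 2;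
  PuccettiWangWang2012, Theorem 3.2].
* `IsCompletelyMixable.map_affine` — affine images; `IsCompletelyMixable.integral_eq` — the
  centre of an integrable `n`-CM law (`n ≠ 0`) is its mean [cite: Wang2015CM, §2.1].

The deep sufficient conditions (monotone densities: `n`-CM iff the mean condition holds,
Wang–Wang 2011 Cor. 2.9 / Wang 2015 §2.2 (b); concave densities; densities `≥ 3/(n(b-a))`) are
NOT in this file.

## References

* R. Wang, *Current open questions in complete mixability*, Probab. Surveys 12 (2015) 13–38,
  arXiv:1411.6190. [Wang2015CM]
* B. Wang, R. Wang, *The complete mixability and convex minimization problems with monotone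
  marginal densities*, J. Multivariate Anal. 102 (2011) 1344–1360. [WangWang2011]
* G. Puccetti, R. Wang, *Extremal dependence concepts*, Statist. Sci. 30 (2015) 485–517,
  arXiv:1512.03232. [PuccettiWang2015]
* G. Puccetti, B. Wang, R. Wang, *Advances in complete mixability*, J. Appl. Probab. 49 (2012)
  430–440. [PuccettiWangWang2012]
-/

namespace Literature.Probability.Distributions

open _root_.MeasureTheory Set Finset Function
open scoped ENNReal

/-! ### Definitions -/

/-- **Joint mixability** [cite: Wang2015CM, §1.3 (Definitions 1–2)]: the tuple of laws
`μ 0, …, μ (n-1)` on `ℝ` is *jointly mixable with joint centre `K`* if there is a probability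
measure `P` on `Fin n → ℝ` (the law of a *joint mix*) whose `i`-th coordinate marginal is `μ i`
for every `i` and under which `∑ i, x i = K` almost surely. -/
def IsJointlyMixable (n : ℕ) (μ : Fin n → Measure ℝ) (K : ℝ) : Prop :=
  ∃ P : Measure (Fin n → ℝ), IsProbabilityMeasure P ∧
    (∀ i, P.map (fun x => x i) = μ i) ∧ ∀ᵐ x ∂P, ∑ i, x i = K

/-- **Complete mixability** [cite: Wang2015CM, Definition 3; WangWang2011, Definition 2.1]:
the law `μ` on `ℝ` is *`n`-completely mixable with centre `c`* if the constant tuple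
`(μ, …, μ)` is jointly mixable with joint centre `n c`, i.e. there are `X₁, …, Xₙ ∼ μ` with
`X₁ + ⋯ + Xₙ = n c` almost surely. -/
def IsCompletelyMixable (n : ℕ) (μ : Measure ℝ) (c : ℝ) : Prop :=
  IsJointlyMixable n (fun _ => μ) ((n : ℝ) * c)

/-- Unfolding of `IsCompletelyMixable` [cite: Wang2015CM, Definition 3]. -/
theorem isCompletelyMixable_iff {n : ℕ} {μ : Measure ℝ} {c : ℝ} :
    IsCompletelyMixable n μ c ↔
      ∃ P : Measure (Fin n → ℝ), IsProbabilityMeasure P ∧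
        (∀ i, P.map (fun x => x i) = μ) ∧ ∀ᵐ x ∂P, ∑ i, x i = (n : ℝ) * c :=
  Iff.rfl

/-! ### Measurability helpers -/

/-- The coordinate sum on `Fin n → ℝ` is measurable. [folklore] -/
private theorem measurable_sum_apply (n : ℕ) : Measurable fun x : Fin n → ℝ => ∑ i, x i :=
  Finset.measurable_sum _ fun i _ => measurable_pi_apply i

/-- The hyperplane `{x | ∑ i, x i = K}` is measurable. [folklore] -/
private theorem measurableSet_sum_eq (n : ℕ) (K : ℝ) :
    MeasurableSet {x : Fin n → ℝ | ∑ i, x i = K} :=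
  measurableSet_eq_fun (measurable_sum_apply n) measurable_const

/-- Precomposition with a map of indices is measurable on `Fin n → ℝ`. [folklore] -/
private theorem measurable_comp_right {n m : ℕ} (σ : Fin m → Fin n) :
    Measurable fun x : Fin n → ℝ => x ∘ σ :=
  measurable_pi_lambda _ fun i => measurable_pi_apply (σ i)

/-! ### Marginals are probability measures; permutation invariance -/

/-- Each marginal of a jointly mixable tuple is a probability measure (immediate from the
definition: the marginals of the joint mix). [cite: Wang2015CM, §1.3, Definitions 1–2] -/
theorem IsJointlyMixable.isProbabilityMeasure {n : ℕ} {μ : Fin n → Measure ℝ} {K : ℝ}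
    (h : IsJointlyMixable n μ K) (i : Fin n) : IsProbabilityMeasure (μ i) := by
  obtain ⟨P, hP, hmarg, -⟩ := h
  rw [← hmarg i]
  exact Measure.isProbabilityMeasure_map (measurable_pi_apply i).aemeasurable

/-- An `n`-CM law (`n ≠ 0`) is a probability measure (immediate from the definition).
[cite: Wang2015CM, Definition 3] -/
theorem IsCompletelyMixable.isProbabilityMeasure {n : ℕ} {μ : Measure ℝ} {c : ℝ}
    (h : IsCompletelyMixable n μ c) (hn : n ≠ 0) : IsProbabilityMeasure μ :=
  IsJointlyMixable.isProbabilityMeasure h ⟨0, Nat.pos_of_ne_zero hn⟩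

/-- Joint mixability is invariant under permuting the tuple of marginals (the definition
depends only on the family of marginals; permute the coordinates of the joint mix).
[cite: Wang2015CM, §1.3, Definition 2] -/
theorem IsJointlyMixable.comp_perm {n : ℕ} {μ : Fin n → Measure ℝ} {K : ℝ}
    (h : IsJointlyMixable n μ K) (σ : Equiv.Perm (Fin n)) :
    IsJointlyMixable n (μ ∘ σ) K := by
  obtain ⟨P, hP, hmarg, hsum⟩ := h
  refine ⟨P.map (fun x => x ∘ σ), Measure.isProbabilityMeasure_map
    (measurable_comp_right σ).aemeasurable, fun i => ?_, ?_⟩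
  · rw [Measure.map_map (measurable_pi_apply i) (measurable_comp_right σ)]
    exact hmarg (σ i)
  · rw [ae_map_iff (measurable_comp_right σ).aemeasurable (measurableSet_sum_eq n K)]
    filter_upwards [hsum] with x hx
    simp only [Function.comp_apply]
    rwa [Equiv.sum_comp σ (fun i => x i)]

/-- **Symmetrisation** [cite: Wang2015CM, Theorem 2 (proof)]: an `n`-CM law `μ` with centre
`c` is the common marginal of a joint mix whose law `P` is invariant under every permutation
of the coordinates (an exchangeable law on `{∑ xᵢ = n c}`).  Conversely such a `P` witnesses
`IsCompletelyMixable n μ c` by definition. -/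
theorem IsCompletelyMixable.exists_perm_invariant {n : ℕ} {μ : Measure ℝ} {c : ℝ}
    (h : IsCompletelyMixable n μ c) :
    ∃ P : Measure (Fin n → ℝ), IsProbabilityMeasure P ∧
      (∀ σ : Equiv.Perm (Fin n), P.map (fun x => x ∘ σ) = P) ∧
      (∀ i, P.map (fun x => x i) = μ) ∧ ∀ᵐ x ∂P, ∑ i, x i = (n : ℝ) * c := by
  obtain ⟨P, hP, hmarg, hsum⟩ := h
  -- the symmetrised law `(n!)⁻¹ ∑_σ P ∘ (· ∘ σ)⁻¹`
  set N : ℝ≥0∞ := (Fintype.card (Equiv.Perm (Fin n)) : ℝ≥0∞) with hN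
  have hN0 : N ≠ 0 := by
    rw [hN, Nat.cast_ne_zero]; exact Fintype.card_ne_zero
  have hNtop : N ≠ ∞ := by rw [hN]; exact ENNReal.natCast_ne_top _
  let Q : Measure (Fin n → ℝ) := Measure.sum fun σ : Equiv.Perm (Fin n) => P.map (fun x => x ∘ σ)
  have hQmap : ∀ τ : Equiv.Perm (Fin n), Q.map (fun x => x ∘ τ) = Q := by
    intro τ
    rw [Measure.map_sum (measurable_comp_right τ).aemeasurable]
    have : (fun σ : Equiv.Perm (Fin n) => (P.map (fun x => x ∘ σ)).map (fun x => x ∘ τ)) =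
        (fun σ : Equiv.Perm (Fin n) => P.map (fun x => x ∘ σ)) ∘ (Equiv.mulRight τ) := by
      funext σ
      simp only [Function.comp_apply, Equiv.coe_mulRight]
      rw [Measure.map_map (measurable_comp_right τ) (measurable_comp_right σ)]
      rfl
    rw [this, Measure.sum_comp_equiv]
  refine ⟨N⁻¹ • Q, ⟨?_⟩, fun τ => ?_, fun i => ?_, ?_⟩
  · -- total mass
    simp only [Measure.smul_apply, smul_eq_mul, Q, Measure.sum_apply_of_countable]
    have : ∀ σ : Equiv.Perm (Fin n), (P.map (fun x => x ∘ σ)) univ = 1 := by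
      intro σ
      rw [Measure.map_apply (measurable_comp_right σ) MeasurableSet.univ, Set.preimage_univ,
        measure_univ]
    simp only [this, tsum_fintype, Finset.sum_const, Finset.card_univ, nsmul_eq_mul, mul_one]
    exact ENNReal.inv_mul_cancel hN0 hNtop
  · rw [Measure.map_smul, hQmap τ]
  · rw [Measure.map_smul]
    simp only [Q]
    rw [Measure.map_sum (measurable_pi_apply i).aemeasurable]
    have : (fun σ : Equiv.Perm (Fin n) => (P.map (fun x => x ∘ σ)).map (fun x => x i)) =
        fun _ => μ := by
      funext σ
      rw [Measure.map_map (measurable_pi_apply i) (measurable_comp_right σ)]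
      exact hmarg (σ i)
    rw [this]
    ext s hs
    simp only [Measure.smul_apply, smul_eq_mul, Measure.sum_apply_of_countable, tsum_fintype,
      Finset.sum_const, Finset.card_univ, nsmul_eq_mul]
    rw [← mul_assoc, ENNReal.inv_mul_cancel hN0 hNtop, one_mul]
  · refine Measure.ae_smul_measure ?_ _
    simp only [Q]
    rw [Measure.ae_sum_iff' (measurableSet_sum_eq n _)]
    intro σ
    rw [ae_map_iff (measurable_comp_right σ).aemeasurable (measurableSet_sum_eq n _)]
    filter_upwards [hsum] with x hx
    simp only [Function.comp_apply]
    rwa [Equiv.sum_comp σ (fun i => x i)]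

/-! ### The necessary mean condition -/

/-- Under a joint mix, each coordinate lies a.s. in the support constraints of its marginal:
if `μ i` gives no mass below `a`, then `a ≤ x i` for `P`-a.e. `x`. [folklore] -/
private theorem ae_le_apply_of_map_eq {n : ℕ} {P : Measure (Fin n → ℝ)} {μ : Measure ℝ} {i : Fin n}
    (hmarg : P.map (fun x => x i) = μ) {a : ℝ} (ha : μ (Iio a) = 0) :
    ∀ᵐ x ∂P, a ≤ x i := by
  have : P {x | x i < a} = 0 := by
    have h := Measure.map_apply (μ := P) (measurable_pi_apply i) (measurableSet_Iio (a := a))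
    rw [hmarg] at h
    rw [← ha, h]
    rfl
  rw [ae_iff]
  simpa only [not_le] using this

/-- Symmetric version of `ae_le_apply_of_map_eq`: no mass above `b` gives `x i ≤ b` a.s.
[folklore] -/
private theorem ae_apply_le_of_map_eq {n : ℕ} {P : Measure (Fin n → ℝ)} {μ : Measure ℝ} {i : Fin n}
    (hmarg : P.map (fun x => x i) = μ) {b : ℝ} (hb : μ (Ioi b) = 0) :
    ∀ᵐ x ∂P, x i ≤ b := by
  have : P {x | b < x i} = 0 := by
    have h := Measure.map_apply (μ := P) (measurable_pi_apply i) (measurableSet_Ioi (a := b))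
    rw [hmarg] at h
    rw [← hb, h]
    rfl
  rw [ae_iff]
  simpa only [not_le] using this

/-- **Necessary condition, upper tail** [cite: WangWang2011, Proposition 2.1; Wang2015CM,
§2.4 (meancd1)]: if `μ` is `n`-CM with centre `c` (`n ≠ 0`) and carries no mass below `a`,
then it carries no mass above `n c - (n-1) a` (since `X₁ = n c - ∑_{i ≥ 2} Xᵢ ≤ n c - (n-1) a`).
-/
theorem IsCompletelyMixable.measure_Ioi_eq_zero {n : ℕ} {μ : Measure ℝ} {c : ℝ}
    (h : IsCompletelyMixable n μ c) (hn : n ≠ 0) {a : ℝ} (ha : μ (Iio a) = 0) :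
    μ (Ioi ((n : ℝ) * c - ((n : ℝ) - 1) * a)) = 0 := by
  obtain ⟨P, hP, hmarg, hsum⟩ := h
  dsimp only at hmarg
  set i₀ : Fin n := ⟨0, Nat.pos_of_ne_zero hn⟩
  have hall : ∀ᵐ x ∂P, ∀ i, a ≤ x i := ae_all_iff.2 fun i => ae_le_apply_of_map_eq (hmarg i) ha
  have hbound : ∀ᵐ x ∂P, x i₀ ≤ (n : ℝ) * c - ((n : ℝ) - 1) * a := by
    filter_upwards [hsum, hall] with x hx ha'
    have hsplit := Finset.add_sum_erase (Finset.univ : Finset (Fin n)) (fun i => x i)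
      (Finset.mem_univ i₀)
    have hcard : ((Finset.univ : Finset (Fin n)).erase i₀).card = n - 1 := by
      rw [Finset.card_erase_of_mem (Finset.mem_univ i₀), Finset.card_univ, Fintype.card_fin]
    have hle : (((Finset.univ : Finset (Fin n)).erase i₀).card : ℝ) * a ≤
        ∑ i ∈ (Finset.univ : Finset (Fin n)).erase i₀, x i := by
      have := Finset.card_nsmul_le_sum ((Finset.univ : Finset (Fin n)).erase i₀) (fun i => x i) a
        (fun i _ => ha' i)
      simpa [nsmul_eq_mul] using this
    rw [hcard, Nat.cast_sub (Nat.pos_of_ne_zero hn), Nat.cast_one] at hle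
    linarith
  have : P {x | (n : ℝ) * c - ((n : ℝ) - 1) * a < x i₀} = 0 := by
    have h' := ae_iff.1 hbound
    simpa only [not_le] using h'
  rw [← hmarg i₀, Measure.map_apply (measurable_pi_apply i₀) measurableSet_Ioi]
  exact this

/-- **Necessary condition, lower tail** (mirror image of `measure_Ioi_eq_zero`): no mass above
`b` forces no mass below `n c - (n-1) b`. [cite: WangWang2011, Proposition 2.1] -/
theorem IsCompletelyMixable.measure_Iio_eq_zero {n : ℕ} {μ : Measure ℝ} {c : ℝ}
    (h : IsCompletelyMixable n μ c) (hn : n ≠ 0) {b : ℝ} (hb : μ (Ioi b) = 0) :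
    μ (Iio ((n : ℝ) * c - ((n : ℝ) - 1) * b)) = 0 := by
  obtain ⟨P, hP, hmarg, hsum⟩ := h
  dsimp only at hmarg
  set i₀ : Fin n := ⟨0, Nat.pos_of_ne_zero hn⟩
  have hall : ∀ᵐ x ∂P, ∀ i, x i ≤ b := ae_all_iff.2 fun i => ae_apply_le_of_map_eq (hmarg i) hb
  have hbound : ∀ᵐ x ∂P, (n : ℝ) * c - ((n : ℝ) - 1) * b ≤ x i₀ := by
    filter_upwards [hsum, hall] with x hx hb'
    have hsplit := Finset.add_sum_erase (Finset.univ : Finset (Fin n)) (fun i => x i)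
      (Finset.mem_univ i₀)
    have hcard : ((Finset.univ : Finset (Fin n)).erase i₀).card = n - 1 := by
      rw [Finset.card_erase_of_mem (Finset.mem_univ i₀), Finset.card_univ, Fintype.card_fin]
    have hle : ∑ i ∈ (Finset.univ : Finset (Fin n)).erase i₀, x i ≤
        (((Finset.univ : Finset (Fin n)).erase i₀).card : ℝ) * b := by
      have := Finset.sum_le_card_nsmul ((Finset.univ : Finset (Fin n)).erase i₀) (fun i => x i) b
        (fun i _ => hb' i)
      simpa [nsmul_eq_mul] using this
    rw [hcard, Nat.cast_sub (Nat.pos_of_ne_zero hn), Nat.cast_one] at hle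
    linarith
  have : P {x | x i₀ < (n : ℝ) * c - ((n : ℝ) - 1) * b} = 0 := by
    have h' := ae_iff.1 hbound
    simpa only [not_le] using h'
  rw [← hmarg i₀, Measure.map_apply (measurable_pi_apply i₀) measurableSet_Iio]
  exact this

/-- **Mean condition, left inequality** [cite: Wang2015CM, §2.4 (meancd1); WangWang2011,
Proposition 2.1]: if an `n`-CM law with centre `c` (`n ≠ 0`) has no mass below `a` and does
charge `[b, ∞)`, then `a + (b - a)/n ≤ c`.  (With `a`, `b` the ends of the essential support this
is the printed condition `a + (b-a)/n ≤ μ`.) -/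
theorem IsCompletelyMixable.mean_condition_left {n : ℕ} {μ : Measure ℝ} {c : ℝ}
    (h : IsCompletelyMixable n μ c) (hn : n ≠ 0) {a b : ℝ} (ha : μ (Iio a) = 0)
    (hb : μ (Ici b) ≠ 0) : a + (b - a) / n ≤ c := by
  have hn' : (0 : ℝ) < n := by exact_mod_cast Nat.pos_of_ne_zero hn
  have hzero := h.measure_Ioi_eq_zero hn ha
  have hble : b ≤ (n : ℝ) * c - ((n : ℝ) - 1) * a := by
    refine le_of_not_gt fun hlt => hb ?_
    exact measure_mono_null (fun x (hx : b ≤ x) => lt_of_lt_of_le hlt hx) hzero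
  rw [add_comm, ← le_sub_iff_add_le, div_le_iff₀ hn']
  linarith

/-- **Mean condition, right inequality** [cite: Wang2015CM, §2.4 (meancd1); WangWang2011,
Proposition 2.1]: if an `n`-CM law with centre `c` (`n ≠ 0`) has no mass above `b` and does
charge `(-∞, a]`, then `c ≤ b - (b - a)/n`. -/
theorem IsCompletelyMixable.mean_condition_right {n : ℕ} {μ : Measure ℝ} {c : ℝ}
    (h : IsCompletelyMixable n μ c) (hn : n ≠ 0) {a b : ℝ} (hb : μ (Ioi b) = 0)
    (ha : μ (Iic a) ≠ 0) : c ≤ b - (b - a) / n := by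
  have hn' : (0 : ℝ) < n := by exact_mod_cast Nat.pos_of_ne_zero hn
  have hzero := h.measure_Iio_eq_zero hn hb
  have hale : (n : ℝ) * c - ((n : ℝ) - 1) * b ≤ a := by
    refine le_of_not_gt fun hlt => ha ?_
    exact measure_mono_null (fun x (hx : x ≤ a) => lt_of_le_of_lt hx hlt) hzero
  rw [le_sub_iff_add_le, ← le_sub_iff_add_le', div_le_iff₀ hn']
  linarith

/-! ### `n = 2`: complete mixability is symmetry -/

/-- The antithetic coupling `x ↦ (x, 2c - x)` as a map `ℝ → (Fin 2 → ℝ)`. [folklore] -/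
def antitheticPair (c : ℝ) (x : ℝ) : Fin 2 → ℝ := fun i => if i = 0 then x else 2 * c - x

/-- `antitheticPair c` is measurable. [folklore] -/
private theorem measurable_antitheticPair (c : ℝ) : Measurable (antitheticPair c) := by
  refine measurable_pi_lambda _ fun i => ?_
  by_cases hi : i = 0
  · simp only [antitheticPair, hi, if_true]; exact measurable_id
  · simp only [antitheticPair, hi, if_false]; exact measurable_const.sub measurable_id

/-- **`2`-CM ⇔ symmetric** [cite: PuccettiWang2015, §3.3: «a bivariate random vector
`(X₁,X₂)` is a joint mix if and only if `X₁ = k - X₂` a.s. …, thus if and only if its marginal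
components are symmetric with respect to `k`»]: a probability law `μ` is `2`-completely mixable
with centre `c` iff it is invariant under the reflection `x ↦ 2c - x`. -/
theorem isCompletelyMixable_two_iff {μ : Measure ℝ} [IsProbabilityMeasure μ] {c : ℝ} :
    IsCompletelyMixable 2 μ c ↔ μ.map (fun x => 2 * c - x) = μ := by
  have hrefl : Measurable fun x : ℝ => 2 * c - x := measurable_const.sub measurable_id
  constructor
  · rintro ⟨P, hP, hmarg, hsum⟩
    dsimp only at hmarg
    have h0 := hmarg 0
    have h1 := hmarg 1
    calc μ.map (fun x => 2 * c - x)
        = (P.map (fun x => x 0)).map (fun x => 2 * c - x) := by rw [h0]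
      _ = P.map ((fun x => 2 * c - x) ∘ fun x => x 0) :=
          Measure.map_map hrefl (measurable_pi_apply 0)
      _ = P.map (fun x => x 1) := by
          apply Measure.map_congr
          filter_upwards [hsum] with x hx
          simp only [Fin.sum_univ_two, Nat.cast_ofNat] at hx
          simp only [Function.comp_apply]
          linarith
      _ = μ := h1
  · intro hsymm
    refine ⟨μ.map (antitheticPair c),
      Measure.isProbabilityMeasure_map (measurable_antitheticPair c).aemeasurable,
      fun i => ?_, ?_⟩
    · rw [Measure.map_map (measurable_pi_apply i) (measurable_antitheticPair c)]
      by_cases hi : i = 0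
      · subst hi
        have : (fun x : Fin 2 → ℝ => x 0) ∘ antitheticPair c = id := by
          funext x; simp [antitheticPair]
        rw [this, Measure.map_id]
      · have : (fun x : Fin 2 → ℝ => x i) ∘ antitheticPair c = fun x => 2 * c - x := by
          funext x; simp [antitheticPair, hi]
        rw [this, hsymm]
    · rw [ae_map_iff (measurable_antitheticPair c).aemeasurable (measurableSet_sum_eq 2 _)]
      refine Filter.Eventually.of_forall fun x => ?_
      simp only [Fin.sum_univ_two, antitheticPair, Nat.cast_ofNat]
      simp only [Fin.one_eq_zero_iff, OfNat.ofNat_ne_one, if_true, if_false]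
      ring

/-! ### Convexity -/

/-- **Convexity of joint mixability**: a convex combination of two jointly mixable tuples
(same joint centre, coordinatewise mixture) is jointly mixable — mix the two joint mixes.
[cite: Wang2015CM, Theorem 2 (proof)] -/
theorem IsJointlyMixable.convexCombo {n : ℕ} {μ ν : Fin n → Measure ℝ} {K : ℝ}
    (hμ : IsJointlyMixable n μ K) (hν : IsJointlyMixable n ν K) {t : ℝ≥0∞} (ht : t ≤ 1) :
    IsJointlyMixable n (fun i => t • μ i + (1 - t) • ν i) K := by
  obtain ⟨P, hP, hPm, hPs⟩ := hμ
  obtain ⟨Q, hQ, hQm, hQs⟩ := hν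
  refine ⟨t • P + (1 - t) • Q, ⟨?_⟩, fun i => ?_, ?_⟩
  · simp only [Measure.add_apply, Measure.smul_apply, smul_eq_mul, measure_univ, mul_one]
    exact add_tsub_cancel_of_le ht
  · rw [Measure.map_add _ _ (measurable_pi_apply i), Measure.map_smul, Measure.map_smul,
      hPm i, hQm i]
  · exact (ae_add_measure_iff).2 ⟨Measure.ae_smul_measure hPs _, Measure.ae_smul_measure hQs _⟩

/-- **Convexity of complete mixability** (the set `ℳₙ(c)` of `n`-CM laws with centre `c` is
convex). [cite: Wang2015CM, Theorem 2 (proof)] -/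
theorem IsCompletelyMixable.convexCombo {n : ℕ} {μ ν : Measure ℝ} {c : ℝ}
    (hμ : IsCompletelyMixable n μ c) (hν : IsCompletelyMixable n ν c) {t : ℝ≥0∞} (ht : t ≤ 1) :
    IsCompletelyMixable n (t • μ + (1 - t) • ν) c :=
  IsJointlyMixable.convexCombo hμ hν ht

/-! ### Discrete uniform laws are completely mixable (cyclic coupling) -/

/-- The `n`-point **discrete uniform law** on the coordinates of `a : Fin n → ℝ`:
`P(X = x) = #{i : a i = x}/n` [cite: Wang2015CM, §2.3]. -/
noncomputable def discreteUniform {n : ℕ} (a : Fin n → ℝ) : Measure ℝ :=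
  ((n : ℝ≥0∞))⁻¹ • Measure.sum fun i => Measure.dirac (a i)

/-- Unfolding of `discreteUniform` [cite: Wang2015CM, §2.3 (n-discrete uniform distribution)]. -/
theorem discreteUniform_def {n : ℕ} (a : Fin n → ℝ) :
    discreteUniform a = ((n : ℝ≥0∞))⁻¹ • Measure.sum fun i => Measure.dirac (a i) := rfl

/-- **Discrete uniform laws are `n`-CM** [cite: Wang2015CM, Theorem 2; PuccettiWangWang2012,
Theorem 3.2]: for `n ≠ 0` the discrete uniform law on `a 0, …, a (n-1)` is `n`-completely
mixable with centre `(∑ i, a i)/n`.  Coupling: pick a uniformly random cyclic shift `j` and set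
`Xᵢ = a (i + j)`; each `Xᵢ` is uniform on the coordinates and `∑ Xᵢ = ∑ aᵢ` surely. -/
theorem isCompletelyMixable_discreteUniform {n : ℕ} (hn : n ≠ 0) (a : Fin n → ℝ) :
    IsCompletelyMixable n (discreteUniform a) ((∑ i, a i) / n) := by
  haveI : NeZero n := ⟨hn⟩
  have hn0 : (n : ℝ≥0∞) ≠ 0 := by exact_mod_cast hn
  have hntop : (n : ℝ≥0∞) ≠ ∞ := ENNReal.natCast_ne_top n
  have hnR : (n : ℝ) ≠ 0 := by exact_mod_cast hn
  -- the cyclic shifts of `a`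
  let shift : Fin n → (Fin n → ℝ) := fun j i => a (i + j)
  let Q : Measure (Fin n → ℝ) := Measure.sum fun j => Measure.dirac (shift j)
  refine ⟨((n : ℝ≥0∞))⁻¹ • Q, ⟨?_⟩, fun i => ?_, ?_⟩
  · simp only [Measure.smul_apply, smul_eq_mul, Q, Measure.sum_apply_of_countable, measure_univ,
      tsum_fintype, Finset.sum_const, Finset.card_univ, Fintype.card_fin, nsmul_eq_mul, mul_one]
    exact ENNReal.inv_mul_cancel hn0 hntop
  · rw [Measure.map_smul, discreteUniform_def]
    congr 1
    simp only [Q]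
    rw [Measure.map_sum (measurable_pi_apply i).aemeasurable]
    have : (fun j : Fin n => (Measure.dirac (shift j)).map (fun x : Fin n → ℝ => x i)) =
        (fun m : Fin n => Measure.dirac (a m)) ∘ (Equiv.addLeft i) := by
      funext j
      rw [Measure.map_dirac' (measurable_pi_apply i)]
      simp [shift]
    rw [this, Measure.sum_comp_equiv]
  · refine Measure.ae_smul_measure ?_ _
    simp only [Q]
    rw [Measure.ae_sum_iff' (measurableSet_sum_eq n _)]
    intro j
    rw [ae_dirac_iff (measurableSet_sum_eq n _)]
    show ∑ i, a (i + j) = (n : ℝ) * ((∑ i, a i) / n)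
    rw [mul_div_cancel₀ _ hnR]
    exact Equiv.sum_comp (Equiv.addRight j) a

/-! ### Affine images and the centre -/

/-- **Affine images** (immediate from the definition: apply `x ↦ α x + β` to every coordinate
of the joint mix): if `μ` is `n`-CM with centre `c` then its image under `x ↦ α x + β` is `n`-CM
with centre `α c + β`. [cite: Wang2015CM, Definition 3] -/
theorem IsCompletelyMixable.map_affine {n : ℕ} {μ : Measure ℝ} {c : ℝ}
    (h : IsCompletelyMixable n μ c) (α β : ℝ) :
    IsCompletelyMixable n (μ.map fun x => α * x + β) (α * c + β) := by
  obtain ⟨P, hP, hmarg, hsum⟩ := h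
  dsimp only at hmarg
  have hg : Measurable fun x : ℝ => α * x + β := (measurable_id.const_mul α).add_const β
  have hG : Measurable fun (x : Fin n → ℝ) (i : Fin n) => α * x i + β :=
    measurable_pi_lambda _ fun i => hg.comp (measurable_pi_apply i)
  refine ⟨P.map fun x i => α * x i + β, Measure.isProbabilityMeasure_map hG.aemeasurable,
    fun i => ?_, ?_⟩
  · rw [Measure.map_map (measurable_pi_apply i) hG, ← hmarg i, Measure.map_map hg
      (measurable_pi_apply i)]
    rfl
  · rw [ae_map_iff hG.aemeasurable (measurableSet_sum_eq n _)]
    filter_upwards [hsum] with x hx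
    simp only [Finset.sum_add_distrib, ← Finset.mul_sum, hx, Finset.sum_const,
      Finset.card_univ, Fintype.card_fin, nsmul_eq_mul]
    ring

/-- **The centre is the mean** [cite: Wang2015CM, §2.1]: if `μ` is `n`-CM with centre `c`,
`n ≠ 0`, and `μ` has a first moment, then `∫ x dμ = c`. -/
theorem IsCompletelyMixable.integral_eq {n : ℕ} {μ : Measure ℝ} {c : ℝ}
    (h : IsCompletelyMixable n μ c) (hn : n ≠ 0) (hint : Integrable (fun x : ℝ => x) μ) :
    ∫ x, x ∂μ = c := by
  obtain ⟨P, hP, hmarg, hsum⟩ := h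
  dsimp only at hmarg
  have hnR : (n : ℝ) ≠ 0 := by exact_mod_cast hn
  have hcoord : ∀ i : Fin n, Integrable (fun x : Fin n → ℝ => x i) P ∧
      ∫ x, x i ∂P = ∫ x, x ∂μ := by
    intro i
    have hm : AEMeasurable (fun x : Fin n → ℝ => x i) P := (measurable_pi_apply i).aemeasurable
    have key : Integrable (fun x : ℝ => x) (P.map fun x => x i) := by rw [hmarg i]; exact hint
    constructor
    · exact (integrable_map_measure key.aestronglyMeasurable hm).1 key
    · rw [← hmarg i, integral_map hm key.aestronglyMeasurable]
  have h1 : ∫ x, (∑ i, x i) ∂P = (n : ℝ) * c := by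
    rw [integral_congr_ae hsum, integral_const]
    simp
  have h2 : ∫ x, (∑ i, x i) ∂P = ∑ i : Fin n, ∫ x, x i ∂P :=
    integral_finsetSum _ fun i _ => (hcoord i).1
  rw [h2] at h1
  simp only [fun i => (hcoord i).2, Finset.sum_const, Finset.card_univ, Fintype.card_fin,
    nsmul_eq_mul] at h1
  exact mul_left_cancel₀ hnR h1

end Literature.Probability.Distributions
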